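import Literature.AlgebraicGeometry.ShimuraVarieties.UnitaryBallConeFormPullback
import Literature.AlgebraicGeometry.ShimuraVarieties.UnitaryBallRationalSubconeDensity
import Literature.AlgebraicGeometry.HodgeTheory.HodgeTypeConjugation
import Literature.AlgebraicGeometry.HodgeTheory.HodgeTypeExteriorProduct
import Literature.AlgebraicGeometry.HodgeTheory.HodgeTypePullback
import Literature.AlgebraicGeometry.HodgeTheory.WeilSurfaceCMSquare
import Literature.AlgebraicGeometry.HodgeTheory.ComplexConjugationHolds
import Literature.AlgebraicGeometry.HodgeTheory.HodgeFiltrationModelsReductionProofs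
import Literature.AlgebraicGeometry.HodgeTheory.BettiUniverseCMAction
import HarnessLib

/-!
# Degree-one classes of a compact ball quotient surface are detected by its compatible special curves —
# PROOF of III-8′ `UnitaryBallUniformisationDatum.MR92Prop6Source` ([MR92] §5 Prop. 6 / Lemma A, Lemma B, Cor. C, with
# [Liu2021] fn. 9 «n − 1»)

Topic `AlgebraicGeometry/ShimuraVarieties`; namespace `Literature.AlgebraicGeometry.ShimuraVarieties.UnitaryBallUniformisationDatum`.
THEOREMS ONLY: no definition, no named fact, no instance, no `sorry`; imports = tree only.  This file DISCHARGES the named fact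
`UnitaryBallUniformisationDatum.MR92Prop6Source` of ★ `UnitaryBallH1RestrictionToSpecialCurves` (cell `hodgecm-mathlib`, crux
`HLiu418`, registered fact-level stub `stub_MR92Prop6Source`): **`mr92Prop6Source (D) : D.MR92Prop6Source`** for EVERY
`D : UnitaryBallUniformisationDatum 2 X`.

PRINTED PROOF ([MurtyRamakrishnan1992] §5, pp. 460–463, text on the cell shelf; [Liu2021] p. 51 fn. 9 reads Lemma B with «`n − 1`»
for «`n − 2`», i.e. with special CURVES): a holomorphic `1`-form on `S_K(ℂ)` killed on the tangent spaces of the special sub-varieties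
through every very special point vanishes (Lemma A: very special points are dense; Lemma B: those tangent spaces span; Cor. C), and a
class of `H¹` is a holomorphic `1`-form plus the conjugate of one.  THE PROOF HERE, for `c ∈ H¹(X(ℂ); ℂ)`, `c ≠ 0`, assuming towards
a contradiction that for every totally positive line `W` some compatible uniformised special curve `(Y, D₁, φ, M)` over `W` has
`φ(ℂ)^* c = 0`:

1. (Hodge bookkeeping, §2) `c = c₁ + c₂` with `c₁` of type `(1,0)` and `c₂` of type `(0,1)` (★ `exists_add_eq_of_isOfHodgeType_one`);
   `φ^*` preserves types (★ `IsOfHodgeType.map_of_isSmoothProjective`) and a class of both types is zero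
   (★ `eq_zero_of_isOfHodgeType_one_zero_of_zero_one` on `Y`), so `φ^* c₁ = 0` and `φ^* c₂ = 0`, hence `φ^* (conj c₂) = 0`
   (★ `conjClass_map`) with `conj c₂` of type `(1,0)` (★ `IsOfHodgeType.conjClass`).  So it suffices to treat `d` of type `(1,0)`.
2. (§1, the heart) `d` of type `(1,0)` with `φ^* d = 0` for a compatible source over EVERY totally positive line is zero:
   let `α` be the holomorphic `1`-form of `d` (★ `oneFormOfClassSurface`) and `G u = α_{ψ u} ∘ dψ_u : ℂ³ →ₗ[ℂ] ℂ` its cone pull-back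
   (`ψ = (X^an ≃ X(ℂ))⁻¹ ∘ unif`, `ℂ`-linear by ★ `UnitaryBallConeFormPullback` §2).  For a compatible source over `W` with `φ^* d = 0`
   the holomorphic `1`-form `(φ^an)^* α` on `Y^an` has class `φ^* d = 0` in the Hodge model of `Y` with comparison INDUCED from that of `X`
   (★ `HodgeModel.induce`, the cross-dimension comparison of ★ `HodgeTypePullback`), hence vanishes (★ `eq_oneFormOfClass_of_holFormClass_eq`,
   Voisin I Cor. 7.6 in degree one: `pullback_anMap_oneFormOfClassSurface_eq_zero`); by the chain rule of ★ `UnitaryBallConeFormPullback` §3,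
   `G` then kills `W^⊥ ⊗ ℂ` at every point of the special sub-cone `negCone ∩ (W^⊥ ⊗ ℂ) = M(negCone H₁)`.  By [MR92] Lemma B + Cor. C on the
   cone (★ `linearForm_eq_zero_of_smul_rational_of_forall_line` of `UnitaryBallRationalSubconeDensity`) `G` vanishes on every `E`-rational
   line of the cone; read in the Sylvester chart (★ `classLift_apply_apply`, `unifDeriv_apply_eq_mfderiv_comp`, `t_mulVec_lift_coneChart`)
   the holomorphic lift `classLift d` vanishes at the chart images of the very special points, which are dense (Lemma A,
   ★ `exists_rational_coneChart_mem`); it is continuous (★ `continuous_classLift`), so it vanishes — contradicting ★ `classLift_ne_zero`.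

Everything used is a theorem of the tree (`exists_isReal_hodgeModel_holds`, `hodgePQ_independent_of_hodgeModel_holds`, …); no named
fact enters.  The statement proved is EXACTLY the `def MR92Prop6Source` (per level, complex points, source form, `p = 2`).

## References
* [MurtyRamakrishnan1992] V. K. Murty, D. Ramakrishnan, *The Albanese of unitary Shimura varieties*, in: The zeta functions of Picard
  modular surfaces (CRM, Montréal 1992), pp. 445–464: §5 Prop. 6 (p. 460), Lemma A (p. 461), Lemma B and its proof (p. 462), Cor. C
  (pp. 462–463).
* [Liu2021] Y. Liu, *Fourier–Jacobi cycles and arithmetic relative trace formula*, Camb. J. Math. 9 (2021), proof of Thm. 4.15,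
  l. 2207, l. 2212 and footnote 9.
* [VoisinHodgeI2002] C. Voisin, *Hodge Theory and Complex Algebraic Geometry I*, §6.1.3 Cor. 6.12, §7.1.1 Cor. 7.6, §7.3.2.
* [SerreGAGA1956] J.-P. Serre, GAGA, §2 n°5–6.
-/

set_option autoImplicit false

noncomputable section

open Matrix Function NumberField CategoryTheory
open scoped Manifold ContDiff Topology TensorProduct
open Literature.Geometry.ComplexHyperbolic
open Literature.Geometry.ComplexHyperbolic.BallModel (Ball)
open Literature.Geometry.Kaehler (MForm holFormsInCharts isOfType_of_mem)
open Literature.NumberTheory.Transcendental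
open Literature.AlgebraicTopology.SingularHomology
open Literature.AlgebraicGeometry.HodgeTheory

namespace Literature.AlgebraicGeometry.ShimuraVarieties

open Literature.AlgebraicGeometry.Motives (SchemeOver ComplexPoints AlgPoints bettiCohomology ofRatClassBaseChange)

namespace UnitaryBallUniformisationDatum

variable {X : SchemeOver ℂ} (D : UnitaryBallUniformisationDatum 2 X)

/-! ### §1 Classes of type `(1,0)`: the holomorphic `1`-form on the compatible curve, and the heart of the proof -/

section OneZero

/-- **The pulled-back holomorphic `1`-form on a curve has the pulled-back class — so it vanishes when that class does** (Voisin I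
§7.3.2 + Cor. 7.6 in degree one).  Let `X` be a smooth projective surface, `η ∈ F¹(ℂ ⊗ H¹(X(ℂ); ℚ))`, `α` its holomorphic `1`-form in
the standard model (★ `oneFormOfClassSurface`), `Y` a smooth projective curve with a Hodge model `A₁`, `φ : Y ⟶ X`.  If `φ^*` kills the
class `Θ' η ∈ H¹(X(ℂ); ℂ)`, then `(φ^an)^* α = 0` on `Y^an`: it is a closed `(1,0)`-form, hence holomorphic; in the Hodge model of `Y`
with de Rham comparison INDUCED from that of `X` (★ `HodgeModel.induce`, `m = 1 ≤ 2 = n`) its class is `φ^*(Θ' η) = 0` (the computation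
of ★ `IsOfHodgeType.map_of_le`); and the degree-one class map is injective (★ `eq_oneFormOfClass_of_holFormClass_eq`).
[cite: VoisinHodgeI2002, §7.3.2 and §7.1.1 Cor. 7.6] [cite: SerreGAGA1956, §2 n°5] -/
theorem pullback_anMap_oneFormOfClassSurface_eq_zero (A : HodgeModel 2 X) (hX : Motives.IsSmoothProjective 2 X)
    {Y : SchemeOver ℂ} (hY : Motives.IsSmoothProjective 1 Y) (A₁ : HodgeModel 1 Y) (φ : Y ⟶ X)
    {η : ℂ ⊗[ℚ] bettiCohomology X 1} (hcp : η ∈ A.ratPiece hX 1 1 0)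
    (hpull : singularCohomology.map ℂ ℂ (AlgPoints.mapContinuous (L := ℂ) φ) 1 (ofRatClassBaseChange (ComplexPoints X) 1 η) = 0) :
    ((A.oneFormOfClassSurface hX η : MForm 𝓘(ℝ, A.model) A.carrier ℂ 1)).pullback
      𝓘(ℝ, A₁.model) (HodgeModel.anMap A A₁ φ) = 0 := by
  haveI : CompleteSpace A.model := FiniteDimensional.complete ℂ A.model
  haveI : CompleteSpace A₁.model := FiniteDimensional.complete ℂ A₁.model
  have hcl : A.HolFormsClosed 1 := A.holFormsClosed_of_finrank_succ hX
  set α := A.oneFormOfClassSurface hX η with hαdef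
  -- the analytified morphism and the pulled-back form
  have hfan : ContMDiff 𝓘(ℝ, A₁.model) 𝓘(ℝ, A.model) ∞ (HodgeModel.anMap A A₁ φ) :=
    HodgeModel.contMDiff_anMap A A₁ φ hY hX
  have hfan' : MDifferentiable 𝓘(ℂ, A₁.model) 𝓘(ℂ, A.model) (HodgeModel.anMap A A₁ φ) :=
    HodgeModel.mdifferentiable_anMap A A₁ φ hY hX
  set β : MForm 𝓘(ℝ, A₁.model) A₁.carrier ℂ 1 :=
    (α : MForm 𝓘(ℝ, A.model) A.carrier ℂ 1).pullback 𝓘(ℝ, A₁.model) (HodgeModel.anMap A A₁ φ) with hβdef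
  have hβc : β ∈ cclosedSmoothForms A₁.model A₁.carrier 1 := pullback_mem_cclosedSmoothForms hfan (hcl α)
  have hβt : IsOfType 1 0 β := (isOfType_of_mem α).pullback hfan'
  have hβh : β ∈ holFormsInCharts A₁.model A₁.carrier 1 :=
    mem_holFormsInCharts_of_isClosedForm_of_isOfType_one_zero
      ((mem_cclosedSmoothForms_iff β).1 hβc).1 ((mem_cclosedSmoothForms_iff β).1 hβc).2 hβt
  -- the Hodge model of `Y` with comparison induced from `A`
  have h12 : (1 : ℕ) ≤ 2 := by norm_num
  have hclB : (A₁.induce A h12).HolFormsClosed 1 := (A₁.induce A h12).holFormsClosed_top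
  -- the class of `α` in `A` is `Θ' η` pulled back to `X^an`
  have hwc : A.deRham A.carrier 1 (complexDeRhamCohomology.mk A.model A.carrier 1 ⟨α, hcl α⟩) =
      A.pullback 1 (ofRatClassBaseChange (ComplexPoints X) 1 η) := by
    have h := A.holFormClass_oneFormOfClassSurface_of_mem_ratPiece hX hcp
    rw [HodgeModel.holFormClass_apply, HodgeModel.complexification_apply] at h
    exact h
  -- the class of `β` in the induced model is `φ^* (Θ' η) = 0`
  have hclass : (A₁.induce A h12).holFormClass 1 hclB ⟨β, hβh⟩ = (A₁.induce A h12).complexification hY 1 0 := by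
    rw [map_zero, HodgeModel.holFormClass_apply]
    have hmk : complexDeRhamCohomology.mk A₁.model A₁.carrier 1 ((A₁.induce A h12).holFormsToClosed 1 hclB ⟨β, hβh⟩) =
        complexDeRhamCohomology.map A₁.model hfan 1 (complexDeRhamCohomology.mk A.model A.carrier 1 ⟨α, hcl α⟩) := by
      rw [complexDeRhamCohomology.map_mk]
      rfl
    change HodgeModel.inducedIso A A₁ h12 A₁.carrier 1
        (complexDeRhamCohomology.mk A₁.model A₁.carrier 1 ((A₁.induce A h12).holFormsToClosed 1 hclB ⟨β, hβh⟩)) = 0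
    rw [hmk, HodgeModel.inducedIso_apply, ← LinearMap.comp_apply (g := complexDeRhamCohomology.map A₁.model hfan 1),
      ← complexDeRhamCohomology.map_comp hfan (contMDiff_cylFst A A₁ h12 A₁.carrier),
      A.deRham_isNatural (Cyl A A₁ h12 A₁.carrier) A.carrier _ (hfan.comp (contMDiff_cylFst A A₁ h12 A₁.carrier)) 1 _,
      hwc]
    change ((singularCohomology.map ℂ ℂ _ 1 ≫ singularCohomology.map ℂ ℂ _ 1).hom _) = 0
    rw [← singularCohomology.map_comp]
    change singularCohomology.map ℂ ℂ ⟨HodgeModel.anMap A A₁ φ, HodgeModel.continuous_anMap A A₁ φ⟩ 1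
      (A.pullback 1 (ofRatClassBaseChange (ComplexPoints X) 1 η)) = 0
    rw [HodgeModel.map_anMap_pullback, hpull, map_zero]
  -- hence `β` is the form of the zero class
  have hβeq : (⟨β, hβh⟩ : holFormsInCharts A₁.model A₁.carrier 1) = (A₁.induce A h12).oneFormOfClass hY hclB 0 :=
    (A₁.induce A h12).eq_oneFormOfClass_of_holFormClass_eq hY hclB hclass
  rw [map_zero] at hβeq
  exact congrArg Subtype.val hβeq

/-- **The heart: a class of type `(1,0)` killed on a compatible special curve over EVERY totally positive line is zero**
([MR92] §5 Lemma A + Lemma B + Cor. C for its holomorphic `1`-form `α`).  The cone pull-back `G u = α_{ψ u} ∘ dψ_u` is a field of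
`ℂ`-linear forms on the cone which — by `pullback_anMap_oneFormOfClassSurface_eq_zero` and the chain rule along each compatible
source — kills `W^⊥ ⊗ ℂ` along the special sub-cone of every totally positive line `W`; by Lemma B + Cor. C on the cone it vanishes
on every `E`-rational line, so the holomorphic lift `classLift d` vanishes at the (dense, Lemma A) chart images of the very special
points, hence everywhere by continuity — contradicting `classLift_ne_zero` unless `d = 0`.
[cite: MurtyRamakrishnan1992, §5 Lemma A, Lemma B, Cor. C (pp. 461–463)] [cite: Liu2021, proof of Thm. 4.15, l. 2212 and footnote 9] -/
theorem eq_zero_of_isOfHodgeType_one_zero_of_forall_line {d : complexBetti X 1} (hd : IsOfHodgeType 2 X 1 1 0 d)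
    (H : ∀ W : Submodule D.E (Fin 3 → D.E), IsTotallyPositive (conjRingHom D.E) D.H W → Module.finrank D.E W = 1 →
      ∃ (Y : SchemeOver ℂ) (D₁ : UnitaryBallUniformisationDatum 1 Y) (φ : Y ⟶ X) (M : Matrix (Fin 3) (Fin 2) ℂ),
        D.IsCompatibleSpecialSource W D₁ φ M ∧
          singularCohomology.map ℂ ℂ (AlgPoints.mapContinuous (L := ℂ) φ) 1 d = 0) :
    d = 0 := by
  have hHD := exists_isReal_hodgeModel_holds
  have hI := hodgePQ_independent_of_hodgeModel_holds
  have hX := D.isSmoothProjective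
  obtain ⟨𝔣⟩ := D.nonempty_sylvesterFrame
  haveI : CompleteSpace (Fin 2 → ℂ) := FiniteDimensional.complete ℂ (Fin 2 → ℂ)
  set A := stdModel hHD hX with hA
  -- the rational-tensor avatar `η` of `d` and its membership in `F¹`
  set η : ℂ ⊗[ℚ] bettiCohomology X 1 := (ofRatClassBaseChangeEquiv hX 1).symm d with hηdef
  have hηd : ofRatClassBaseChange (ComplexPoints X) 1 η = d := by
    rw [← ofRatClassBaseChangeEquiv_apply hX 1, hηdef, LinearEquiv.apply_symm_apply]
  have hηF : η ∈ (BettiUniverse.hodge hHD hX 1).F 1 := (BettiUniverse.mem_hodge_F_one_iff hHD hI hX η).2 (by rw [hηd]; exact hd)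
  by_contra h0
  have hη0 : η ≠ 0 := by
    intro h
    apply h0
    rw [← hηd, h, map_zero]
  -- the holomorphic `1`-form of `d` and its holomorphic lift
  set α := A.oneFormOfClassSurface hX η with hαdef
  have hαlin : IsComplexLinearForm (α : MForm 𝓘(ℝ, Fin 2 → ℂ) A.carrier ℂ 1) := (isOfType_of_mem α).isComplexLinearForm
  have hne : D.classLift hHD 𝔣 η ≠ 0 := D.classLift_ne_zero hHD 𝔣 hI hηF hη0
  apply hne
  -- the cone pull-back of `α` as a field of `ℂ`-linear forms (zero off the cone)
  classical
  set ψ : (Fin 3 → ℂ) → A.carrier := ⇑A.isAnalytification.homeomorph.symm ∘ D.unif with hψ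
  let G : (Fin 3 → ℂ) → (Fin 3 → ℂ) →ₗ[ℂ] ℂ := fun u ↦
    if hu : u ∈ D.cone then
      { toFun := fun t ↦ (α : MForm 𝓘(ℝ, Fin 2 → ℂ) A.carrier ℂ 1) (ψ u)
          (fun _ ↦ mfderiv 𝓘(ℝ, Fin 3 → ℂ) 𝓘(ℝ, Fin 2 → ℂ) ψ u t)
        map_add' := fun t t' ↦ D.mform_apply_mfderiv_symm_comp_unif_add A _ u t t'
        map_smul' := fun c t ↦ by
          rw [RingHom.id_apply, smul_eq_mul]
          exact D.mform_apply_mfderiv_symm_comp_unif_smul A hαlin hu c t }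
    else 0
  have hG_apply : ∀ {u : Fin 3 → ℂ} (hu : u ∈ D.cone) (t : Fin 3 → ℂ),
      G u t = (α : MForm 𝓘(ℝ, Fin 2 → ℂ) A.carrier ℂ 1) (ψ u) (fun _ ↦ mfderiv 𝓘(ℝ, Fin 3 → ℂ) 𝓘(ℝ, Fin 2 → ℂ) ψ u t) := by
    intro u hu t
    simp only [G, dif_pos hu]
    rfl
  -- `G` kills `W^⊥ ⊗ ℂ` along the special sub-cone of every totally positive line `W`
  have hG : ∀ W : Submodule D.E (Fin 3 → D.E), IsTotallyPositive (conjRingHom D.E) D.H W → Module.finrank D.E W = 1 →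
      ∀ u ∈ D.cone, (∀ w ∈ W, hermForm (starRingEnd ℂ) D.Hℂ (fun i ↦ (w i : ℂ)) u = 0) →
        ∀ t : Fin 3 → ℂ, (∀ w ∈ W, hermForm (starRingEnd ℂ) D.Hℂ (fun i ↦ (w i : ℂ)) t = 0) → G u t = 0 := by
    intro W hW h1 u hu huW t htW
    obtain ⟨Y, D₁, φ, M, hc, hpull⟩ := H W hW h1
    obtain ⟨v', rfl⟩ := hc.exists_eq_mulVec_of_forall_hermForm_eq_zero D hW h1 huW
    obtain ⟨t', rfl⟩ := hc.exists_eq_mulVec_of_forall_hermForm_eq_zero D hW h1 htW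
    have hv' : v' ∈ D₁.cone := (hc.mulVec_mem_negCone_iff D v').1 hu
    set A₁ := stdModel hHD D₁.isSmoothProjective with hA₁
    rw [hG_apply hu, hc.mform_apply_mfderiv_mulVec_eq_pullback D A A₁ _ hv' t']
    rw [← hηd] at hpull
    have hcp : η ∈ A.ratPiece hX 1 1 0 := mem_ratPiece_stdModel_of_mem_hodge_F hHD hI hX hηF
    rw [pullback_anMap_oneFormOfClassSurface_eq_zero A hX D₁.isSmoothProjective A₁ φ hcp hpull]
    rfl
  -- hence `G` vanishes on every `E`-rational line of the cone ([MR92] Lemma B + Cor. C on the cone)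
  have hGrat : ∀ (v₀ : Fin 3 → D.E) (hv₀ : (fun i ↦ (v₀ i : ℂ)) ∈ D.cone) {v : Fin 3 → ℂ} (hv : v ∈ D.cone)
      {c : ℂ} (hcv : v = c • fun i ↦ (v₀ i : ℂ)), G v = 0 :=
    fun v₀ _ v hv c hcv ↦ D.linearForm_eq_zero_of_smul_rational_of_forall_line G hG hv hcv
  -- and the holomorphic lift vanishes at the chart image of every very special point
  have hrat : ∀ (v₀ : Fin 3 → D.E) (hv₀ : (fun i ↦ (v₀ i : ℂ)) ∈ D.cone) (i : Fin 2),
      D.classLift hHD 𝔣 η (D.coneChart 𝔣 ⟨fun i ↦ (v₀ i : ℂ), hv₀⟩) i = 0 := by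
    intro v₀ hv₀ i
    set z := D.coneChart 𝔣 ⟨fun i ↦ (v₀ i : ℂ), hv₀⟩ with hz
    have hflc : 𝔣.t *ᵥ ![z.1 0, z.1 1, 1] ∈ D.cone := (D.coneLift 𝔣 z).2
    have hfl : 𝔣.t *ᵥ ![z.1 0, z.1 1, 1] = ((𝔣.ti *ᵥ fun i ↦ (v₀ i : ℂ)) 2)⁻¹ • fun i ↦ (v₀ i : ℂ) :=
      D.t_mulVec_lift_coneChart 𝔣 ⟨fun i ↦ (v₀ i : ℂ), hv₀⟩
    have hG0 : G (𝔣.t *ᵥ ![z.1 0, z.1 1, 1]) = 0 := hGrat v₀ hv₀ hflc hfl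
    rw [D.classLift_apply_apply hHD 𝔣 η z i, ← hαdef, D.unifDeriv_apply_eq_mfderiv_comp A 𝔣 z,
      D.modelUnif_eq_symm_comp_unif A 𝔣]
    have h := LinearMap.congr_fun hG0
      (mfderiv 𝓘(ℝ, Fin 2 → ℂ) 𝓘(ℝ, Fin 3 → ℂ) (fun w : Fin 2 → ℂ ↦ 𝔣.t *ᵥ ![w 0, w 1, 1]) z.1 (Pi.single i 1))
    rw [hG_apply hflc, LinearMap.zero_apply] at h
    exact h
  -- density of the very special points in the chart + continuity of the lift
  funext z i
  by_contra hzi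
  have hO : IsOpen {z' : Ball | D.classLift hHD 𝔣 η z' i ≠ 0} :=
    isOpen_ne.preimage ((continuous_apply i).comp (D.continuous_classLift hHD 𝔣 η))
  obtain ⟨v₀, hv₀, hmem⟩ := D.exists_rational_coneChart_mem 𝔣 hO ⟨z, hzi⟩
  exact hmem (hrat v₀ hv₀ i)

end OneZero

/-! ### §2 The Hodge bookkeeping and the theorem -/

section Main

/-- **[MR92] Prop. 6 / [Liu2021] Thm. 4.15 proof l. 2212 + fn. 9, III-8′ SOURCE form — PROVED.**  For a compact ball quotient surface
`X(ℂ) ≅ Γ \ 𝔹²` presented by `D : UnitaryBallUniformisationDatum 2 X`, every non-zero class `c ∈ H¹(X(ℂ); ℂ)` admits a totally positive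
definite `E`-line `W ⊆ V` such that for every compatible uniformised special curve `(Y, D₁, φ, M)` over `(D, W)` the pull-back
`φ(ℂ)^* c ∈ H¹(Y(ℂ); ℂ)` is non-zero.  (If not, `c = c₁ + c₂` with `c₁ ∈ H^{1,0}`, `c₂ ∈ H^{0,1}`; pull-back preserves types and the
two types are disjoint on `Y`, so `c₁` and `conj c₂ ∈ H^{1,0}` are each killed on a compatible source over every totally positive line;
`eq_zero_of_isOfHodgeType_one_zero_of_forall_line` gives `c₁ = conj c₂ = 0`, so `c = 0`.)  This discharges the named fact
`MR92Prop6Source D`. [cite: MurtyRamakrishnan1992, §5 Prop. 6, Lemma A, Lemma B, Cor. C (pp. 460–463)]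
[cite: Liu2021, proof of Thm. 4.15, l. 2212 and footnote 9] [cite: VoisinHodgeI2002, §6.1.3 Cor. 6.12 and §7.3.2] -/
theorem mr92Prop6Source : D.MR92Prop6Source := by
  intro c hc
  by_contra H
  push Not at H
  -- `H : ∀ W, totally positive → finrank 1 → ∃ compatible source with pull-back zero`
  have hX := D.isSmoothProjective
  apply hc
  obtain ⟨c₁, c₂, hsum, h₁, h₂⟩ := exists_add_eq_of_isOfHodgeType_one (n := 2) hX c
  -- on every compatible source with `φ^* c = 0`, both `φ^* c₁` and `φ^* c₂` vanish
  have hsplit : ∀ {Y : SchemeOver ℂ} (D₁ : UnitaryBallUniformisationDatum 1 Y) (φ : Y ⟶ X),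
      singularCohomology.map ℂ ℂ (AlgPoints.mapContinuous (L := ℂ) φ) 1 c = 0 →
        singularCohomology.map ℂ ℂ (AlgPoints.mapContinuous (L := ℂ) φ) 1 c₁ = 0 ∧
          singularCohomology.map ℂ ℂ (AlgPoints.mapContinuous (L := ℂ) φ) 1 c₂ = 0 := by
    intro Y D₁ φ h0
    have hY := D₁.isSmoothProjective
    have h₁' : IsOfHodgeType 1 Y 1 1 0 (complexBetti.map φ 1 c₁) := h₁.map_of_isSmoothProjective hY hX φ
    have h₂' : IsOfHodgeType 1 Y 1 0 1 (complexBetti.map φ 1 c₂) := h₂.map_of_isSmoothProjective hY hX φ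
    have hadd : complexBetti.map φ 1 c₁ + complexBetti.map φ 1 c₂ = 0 := by
      rw [← map_add, hsum]
      exact h0
    have hneg : complexBetti.map φ 1 c₁ = -complexBetti.map φ 1 c₂ := eq_neg_of_add_eq_zero_left hadd
    have h₁'' : IsOfHodgeType 1 Y 1 0 1 (complexBetti.map φ 1 c₁) := by
      rw [hneg]
      exact h₂'.neg
    have hz₁ : complexBetti.map φ 1 c₁ = 0 := eq_zero_of_isOfHodgeType_one_zero_of_zero_one hY h₁' h₁''
    refine ⟨hz₁, ?_⟩
    have := hadd
    rw [hz₁, zero_add] at this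
    exact this
  -- `c₁ = 0`
  have hc₁ : c₁ = 0 := by
    refine D.eq_zero_of_isOfHodgeType_one_zero_of_forall_line h₁ fun W hW h1 ↦ ?_
    obtain ⟨Y, D₁, φ, M, hcs, h0⟩ := H W hW h1
    exact ⟨Y, D₁, φ, M, hcs, (hsplit D₁ φ h0).1⟩
  -- `conj c₂ = 0`, hence `c₂ = 0`
  have hc₂' : HodgeTheory.conjClass (ComplexPoints X) 1 c₂ = 0 := by
    refine D.eq_zero_of_isOfHodgeType_one_zero_of_forall_line (h₂.conjClass hX) fun W hW h1 ↦ ?_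
    obtain ⟨Y, D₁, φ, M, hcs, h0⟩ := H W hW h1
    refine ⟨Y, D₁, φ, M, hcs, ?_⟩
    rw [← HodgeTheory.conjClass_map, (hsplit D₁ φ h0).2, HodgeTheory.conjClass_zero]
  have hc₂ : c₂ = 0 := by
    rw [← HodgeTheory.conjClass_conjClass c₂, hc₂', HodgeTheory.conjClass_zero]
  rw [← hsum, hc₁, hc₂, add_zero]

/-- **The datum-universal form** (the shape of the registered fact-level stub `stub_MR92Prop6Source` of the cell's crux `HLiu418`):
III-8′ holds for every compact ball quotient surface datum. [cite: MurtyRamakrishnan1992, §5 Prop. 6 (p. 460)]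
[cite: Liu2021, proof of Thm. 4.15, l. 2212 and footnote 9] -/
theorem mr92Prop6Source_forall : ∀ {X : SchemeOver ℂ} (D : UnitaryBallUniformisationDatum 2 X), D.MR92Prop6Source :=
  fun D ↦ D.mr92Prop6Source

end Main

end UnitaryBallUniformisationDatum

end Literature.AlgebraicGeometry.ShimuraVarieties

end
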